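import Summits.BirchSwinnertonDyer.Rank1Residual.Additive.StrictSelmerIndex
import Literature.NumberTheory.EllipticCurves.Castella2018.AnticyclotomicSelmerDual
import Literature.NumberTheory.EllipticCurves.HeegnerPoints
import Literature.NumberTheory.EllipticCurves.Wuthrich2014.ShaBoundProofs
import Literature.NumberTheory.EllipticCurves.Disegni2020.PAdicBSDRankOneMultiplicativeProofs
import HarnessLib

/-!
# O11 (CM, analytic rank one, the RAMIFIED prime `p = |d_K| ≥ 5`): the elliptic-unit / strict
# anticyclotomic descent TYPED — (R-tors), (R-ctrl), (R-EU) on the tree's REAL anticyclotomic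
# Selmer dual `AcSelmer.XAc (W.baseChange K) p κ 𝔭 ∅ γ` — and the PROVED consumer `⟹ BSDp W p`
# (cell `bsd-cm`, seat `bsd-cm-ram`; memo `HOME/bsd-cm-ram/O11-RAMIFIED-DESCENT.md`)

HONEST FRAMING (cell `bsd-cm`, run/shared/lean/pub/bsd-cm/, verbatim in every file of the cell): the
programme isolates, for CM elliptic curves over `ℚ` of analytic rank `≤ 1`, classes on which the FULL
BSD formula is reduced — strictly by PUBLISHED theorems entering as named-fact binders — to ONE local
problem at ONE prime, and then TYPES that residual problem for construction seats. THIS FILE types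
the residual problem O11 (CM, `r_an = 1`, `p = |d_K| ≥ 5` the prime RAMIFIED in the CM field `K`;
always `p ∣ N`, additive potentially supersingular, `E[p]` reducible) as THREE `@[conjecture]` inputs
— NOTHING asserted — and PROVES the consumer: (R-tors) ∧ (R-ctrl) ∧ (R-EU) ⟹ Miller's `BSD(E,p)`.
No named fact is minted; O11 and the headline class 𝒞₇ (`X12/CMSevenAwayFromSeven.lean`: full BSD
on 𝒞₇ ⟺ `BSDp W 7`) stay OPEN; nothing is booked.

## The mathematics (memo §§0–4; source of the Λ-adic input: Burungale–Kobayashi–Nakamura–Ota,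
## arXiv:2608.06879 = [BKNO], a PREPRINT, read in full; Rubin, LNM 1716 (1999) §12; Greenberg LNM 1716)

Let `E/ℚ` have CM by `𝒪_K`, `p ≥ 5` ramified in `K` (`𝔭² = (p)`, `𝒪 := 𝒪_{K_𝔭}`, residue field
`𝔽_p`), `ord_{s=1} L(E,s) = 1`, `E' := E^{(d_K)}` (which is `p`-isogenous to `E` over `ℚ`, kernel
`E[𝔭]`). Over the anticyclotomic `ℤ_p`-extension `K^ac_∞/K` let `X := X^ac_str` be the Pontryagin
dual of the STRICT-at-`𝔭` Selmer group of `E[p^∞]` — for our curves every local condition away from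
`p` is automatically `0` (CM ⇒ all bad primes additive; `p ≥ 5` ⇒ `E[p^∞]^{I_v} = 0` and
`H¹(K^ac_{∞,w}, E[p^∞]) = 0` for `w ∤ p`, memo (LV1)–(LV3)), so `X` IS the tree's
`AcSelmer.XAc (W.baseChange K) p κ 𝔭 ∅ γ` (Castella's `X_ac^∅`, strict at the unique `𝔭 ∣ p`) as a
`ℤ_p⟦T⟧`-module, `T = γ − 1`. [BKNO, Prop. 3.7 (2)] (Euler system of elliptic units): `X` is
`Λ`-torsion; [BKNO, Thm. 3.14 (3)] (⇐ Rubin 1991 Thm. 4.1 + Johnson-Leung–Kings 2011 Thm. 5.2 + a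
`Λ → Λ^ac` descent): `Ch_Λ(X) = Ch_Λ(S^ac_rel/Λ·z^ac)`, the ELLIPTIC-UNIT index ideal. Memo §3 (OUR
derivation): (Step 1) Greenberg–Wiles + GZK: `Sel_str(E/K)[p^∞]` is finite of `𝒪`-length
`length Ш(E/K)[p^∞] + ν`, `ν = n + n'` the `p`-divisibility levels of generators of `E(ℚ)`, `E'(ℚ)`
in `E(ℚ_p)`, `E'(ℚ_p)`, and `Sel_str(E/K) = Sel_str(E/ℚ) ⊕ Sel_str(E'/ℚ)`; (Step 2) EXACT control
`Sel_str(E/K)[p^∞] ≅ Sel_str(K^ac_∞)[γ−1]` (zero error terms); (Step 3) Euler characteristic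
`#X/TX = |f(0)|_p⁻¹ · #X[T]`. Whence (R-ctrl): `ord_p f(0) + log_p #X[T] = log_p #Sel_str(E/ℚ)[p^∞] +
log_p #Sel_str(E'/ℚ)[p^∞]`, where by [BKNO, Thm. 3.14 (3)] the left side is `ord_π 𝔠`, `𝔠 :=
[E(K) ⊗ ℤ_p : 𝒪·z(𝟙)]` the index of the BOTTOM elliptic-unit (= Kato zeta) class `z(𝟙) ∈ E(K) ⊗ ℤ_p`
(which is NON-ZERO in rank one: memo R-ram-5). The `p`-part of BSD for `E` (⟺ for `E'`, Cassels) is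
then EQUIVALENT to the ONE missing analytic identity (R-EU) = memo (★_an):
`ord_π 𝔠 = ν + ord_p #Ш_an(E) + ord_p #Ш_an(E')` — Perrin-Riou's conjecture (1993) for the CM zeta
element at the additive, potentially supersingular, residually reducible prime `p = |d_K|`, in
valuation form; equivalently ([BKNO, Thm. 7.2]) a BDP-type formula for BKNO's `L_p(E)(𝟙)`, announced
there as "report elsewhere" (§1.4). NOT IN PRINT. This is the irreducible construction of O11.

## What is typed / proved here

* `O11.IsFrame W p K 𝔭 W' C` — PREDICATE (plain definition, nothing asserted): the data of the
  frame (`W` CM, `p ≥ 5` CM-ramified, `K` the CM field as a number field with `discr K = d_K`, `𝔭 ∋ p`,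
  `W'` a globally minimal model of the twist `W^{(d_K)}`).
* (R-tors) `O11.RamifiedCMStrictTorsionAt W p` — `@[conjecture]`: in analytic rank one, `X` is
  `Λ`-torsion with principal characteristic ideal of non-zero constant term (`XAc.HasCharValuationAt … n₀`
  for some `n₀`) and `X[T]` is finite. STATUS: torsion = [BKNO, Prop. 3.7 (2)] (PRE); the rest = memo
  §3 Steps 1–2 (our derivation, routine). Nothing asserted.
* (R-ctrl) `O11.RamifiedCMStrictControlAt W p` — `@[conjecture]`: the EXACT control identity above.
  STATUS: DERIVED in the memo (§3 Steps 1–3) from GZK + (LV1)–(LV3) + the Euler-characteristic lemma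
  for `ℤ_p⟦T⟧`-modules; theorem-level, NOT yet kernel-proved (no structure theory of `ℤ_p⟦T⟧`-modules
  in the tree). Nothing asserted.
* (R-EU) `O11.RamifiedCMEllipticUnitIndexAt W p` — `@[conjecture]`: the MISSING INPUT (★_an). Given
  (R-ctrl) and the discharged index theorem it is EQUIVALENT to `BSDp W p ∧ BSDp W' p`; its CONTENT is
  the identification of `n₀ + log_p #X[T]` with the elliptic-unit index `ord_π 𝔠` ([BKNO, Thm. 3.14 (3)]),
  which makes it a statement about elliptic units (Perrin-Riou's conjecture), not about `Ш`. OPEN.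
* `O11.bsdp_of_halves` — PROVED: (R-tors) ∧ (R-ctrl) ∧ (R-EU) at a framed pair of analytic rank one
  ⟹ `BSDp W p`, from the DISCHARGED index theorem `StrictSha.strictSelmerIndexAt_holds` (for `W` and
  `W'`), Cassels' isogeny invariance of the BSD quotient (`hCassels`, along `W ∼ W'`), Gross–Zagier
  rationality of `#Ш_an` (`hGZ`), GZK (`hGZK`), modularity (`hmod`). Arithmetic: the two inputs give
  `ord_p #Ш(W) + ord_p #Ш(W') = ord_p #Ш_an(W) + ord_p #Ш_an(W')`; Cassels makes the two defects equal;
  hence both vanish.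

References: [BKNO] A. Burungale, S. Kobayashi, K. Nakamura, K. Ota, arXiv:2608.06879 (2026), Prop. 3.7,
Thm. 3.14, Thm. 5.6, Thm. 6.1, Thm. 7.2, §1.4 [BurungaleKobayashiNakamuraOta2026]; K. Rubin, in LNM 1716
(1999) §12, Thm. 12.19, Prop. 12.18 [GreenbergLNM1716 volume]; R. Greenberg, LNM 1716 §4 Lemma 4.2
[GreenbergLNM1716]; F. Castella, Camb. J. Math. 6 (2018) Def. 2.2 [Castella2018]; J. W. S. Cassels 1965
[Cassels1965ArithmeticVIII]; B. Gross, D. Zagier 1986 I.(7.3) [GrossZagier1986]; R. Miller 2011 Def. 1.1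
[Miller2011LMS]; B. Perrin-Riou, Ann. Inst. Fourier 43 (1993) §3.3 (the conjecture; not held).
-/

noncomputable section

open scoped Classical

open WeierstrassCurve NumberField IsDedekindDomain Field PowerSeries
  Literature.NumberTheory.EllipticCurves
  Literature.NumberTheory.EllipticCurves.Rank1Residual
  Literature.NumberTheory.EllipticCurves.Rank1Residual.Typed
  Literature.NumberTheory.EllipticCurves.Castella2018
  Literature.NumberTheory.GaloisRepresentations
  Summit.BirchSwinnertonDyer.Rank1Residual.Additive

namespace Summit.BirchSwinnertonDyer.Rank1Residual.X12.O11

variable (W : WeierstrassCurve ℚ) [W.IsElliptic] [W.IsGloballyMinimal] (p : ℕ) [Fact p.Prime]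

/-! ## §1 The frame -/

/-- **The O11 frame at `(W, p)`** (a PREDICATE with parameters; nothing asserted): `W` has CM, `p ≥ 5`
is ramified in the CM field (`CMRamified W p`, i.e. `p ∣ d_K`; for `p ≥ 5` this forces
`d_K = cmFieldDiscrOfJ W.j = −p`), `K` is an imaginary quadratic number field with `discr K = d_K`
(the CM field), `𝔭` is a prime of `K` above `p` (the unique, ramified one), and `W'` is a globally
minimal model of the quadratic twist `W^{(d_K)}` (`C • W.quadraticTwist d_K = W'`), which is
`p`-isogenous to `W` over `ℚ` (multiplication by `√d_K`). A conjunction of tree predicates; no mathematical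
content of its own. [folklore] -/
@[folklore] def IsFrame (K : Type) [Field K] [NumberField K] (𝔭 : HeightOneSpectrum (𝓞 K))
    (W' : WeierstrassCurve ℚ) (C : VariableChange ℚ) : Prop :=
  W.HasCM ∧ CMRamified W p ∧ 5 ≤ p ∧ IsImaginaryQuadratic K ∧
    NumberField.discr K = cmFieldDiscrOfJ W.j ∧ ((p : ℕ) : 𝓞 K) ∈ 𝔭.asIdeal ∧
    C • W.quadraticTwist ((cmFieldDiscrOfJ W.j : ℤ) : ℚ) = W'

/-! ## §2 The three typed inputs (all `@[conjecture]`; nothing asserted) -/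

/-- **(R-tors) TYPED (nothing asserted): torsion-ness and non-degeneracy at the trivial character of
the STRICT anticyclotomic Selmer dual at a CM-ramified prime in analytic rank one.** For a framed pair
`(W, p)` with `r_an(W) = 1`, an anticyclotomic `ℤ_p`-extension `κ` of the CM field `K` with
topological generator `γ`: the `ℤ_p⟦T⟧`-module `X = AcSelmer.XAc (W.baseChange K) p κ 𝔭 ∅ γ`
(dual of the strict-at-`𝔭` Selmer group of `E[p^∞]` over `K^ac_∞`) is torsion with principal
characteristic ideal `(f)`, `f(0) ≠ 0` (`XAc.HasCharValuationAt … n₀`, `n₀ = ord_p f(0)`), and its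
`T`-torsion `X[T]` is finite. STATUS: "torsion" is Burungale–Kobayashi–Nakamura–Ota Prop. 3.7 (2)
(elliptic-unit Euler system; PREPRINT); "`f(0) ≠ 0`, `X[T]` finite" follow from the finiteness of
`Sel_str(E/K)[p^∞]` in rank one (Greenberg–Wiles + GZK) and exact control (memo §3 Steps 1–2).
OUR transcription; nothing asserted; O11 stays OPEN.
[cite: BurungaleKobayashiNakamuraOta2026, Prop. 3.7 (2) and Thm. 3.14 (arXiv:2608.06879 pp. 19–24) (claim; preprint; shape only)]
[cite: Castella2018, Def. 2.2 and Thm. 2.3 (arXiv:1704.06608 p. 5) (the module and the shape `ord_p f(0)`; nothing asserted)] -/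
@[conjecture] def RamifiedCMStrictTorsionAt : Prop :=
  ∀ (K : Type) [Field K] [NumberField K] (𝔭 : HeightOneSpectrum (𝓞 K))
    (W' : WeierstrassCurve ℚ) [W'.IsElliptic] [W'.IsGloballyMinimal] (C : VariableChange ℚ),
    IsFrame W p K 𝔭 W' C → W.analyticRank = 1 →
    ∀ (κ : ZpExtension K p), κ.IsAnticyclotomic →
      ∀ (γ : absoluteGaloisGroup K) [Fact (κ.IsTopGenerator γ)],
        (∃ n₀ : ℕ, AcSelmer.XAc.HasCharValuationAt (W.baseChange K) p κ 𝔭 ∅ γ n₀) ∧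
          Finite {x : AcSelmer.XAc (W.baseChange K) p κ 𝔭 ∅ γ //
            (PowerSeries.X : IwasawaAlgebra p) • x = 0}

/-- **(R-ctrl) TYPED (nothing asserted): EXACT bottom-layer control for the strict anticyclotomic
Selmer group at a CM-ramified prime in analytic rank one.** For a framed pair with `r_an(W) = 1`,
generators `P ∈ W(ℚ)`, `P' ∈ W'(ℚ)` modulo torsion of `p`-divisibility levels `n`, `n'` in
`W(ℚ_p)`, `W'(ℚ_p)` (no `p`-torsion there): whenever `X` has the shape `ord_p f(0) = n₀` and `X[T]`
is finite,
  `n₀ + log_p #X[T] = log_p #Sel_str(W/ℚ)[p^∞] + log_p #Sel_str(W'/ℚ)[p^∞]`.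
Derivation (memo §3, OURS): `Sel_str(E/K)[p^∞] = Sel_str(E/ℚ) ⊕ Sel_str(E'/ℚ)` (`p` odd,
`E' = E^{(d_K)}`); EXACT control `Sel_str(E/K)[p^∞] ≅ Sel_str(K^ac_∞, E[p^∞])^Γ` with ZERO kernel and
cokernel, because `H⁰(K^ac_{∞,𝔭}, E[p^∞]) = 0` (BKNO (3.16)) and `H¹(K_v, E[p^∞]) = 0` at every bad
`v ∤ p` (CM ⇒ additive; `p ≥ 5`); Euler characteristic `#X/TX = |f(0)|_p⁻¹·#X[T]` (Greenberg LNM 1716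
Lemma 4.2 / Rubin LNM 1716 Prop. 12.7). By BKNO Thm. 3.14 (3) the left side is `ord_π` of the bottom
ELLIPTIC-UNIT index `𝔠 = [E(K) ⊗ ℤ_p : 𝒪·z(𝟙)]`. STATUS: theorem-level (our derivation, to be
refereed); NOT kernel-proved (no `ℤ_p⟦T⟧`-module structure theory in the tree); typed as an input.
Nothing asserted. [cite: BurungaleKobayashiNakamuraOta2026, (3.16), Thm. 3.14 (3), Thm. 6.1 (arXiv:2608.06879 pp. 22–24, 35) (claim; preprint; shape only)]
[cite: GreenbergLNM1716, §4 Lemma 4.2 (p. 102)] [cite: Castella2018, Thm. 2.3 (arXiv:1704.06608 p. 5) (shape only)] -/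
@[conjecture] def RamifiedCMStrictControlAt : Prop :=
  ∀ (K : Type) [Field K] [NumberField K] (𝔭 : HeightOneSpectrum (𝓞 K))
    (W' : WeierstrassCurve ℚ) [W'.IsElliptic] [W'.IsGloballyMinimal] (C : VariableChange ℚ),
    IsFrame W p K 𝔭 W' C → W.analyticRank = 1 →
    ∀ (κ : ZpExtension K p), κ.IsAnticyclotomic →
      ∀ (γ : absoluteGaloisGroup K) [Fact (κ.IsTopGenerator γ)]
        (P : W.toAffine.Point) (n : ℕ) (P' : W'.toAffine.Point) (n' : ℕ),
        ¬ IsOfFinAddOrder P →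
        (∀ R : W.toAffine.Point, ∃ (k : ℤ) (T : W.toAffine.Point), IsOfFinAddOrder T ∧ R = k • P + T) →
        (∀ Q : (W.baseChange ℚ_[p]).toAffine.Point, p • Q = 0 → Q = 0) →
        (∃ Q : (W.baseChange ℚ_[p]).toAffine.Point, p ^ n • Q = W.toPadicPoint p P) →
        (∀ Q : (W.baseChange ℚ_[p]).toAffine.Point, p ^ (n + 1) • Q ≠ W.toPadicPoint p P) →
        ¬ IsOfFinAddOrder P' →
        (∀ R : W'.toAffine.Point, ∃ (k : ℤ) (T : W'.toAffine.Point),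
          IsOfFinAddOrder T ∧ R = k • P' + T) →
        (∀ Q : (W'.baseChange ℚ_[p]).toAffine.Point, p • Q = 0 → Q = 0) →
        (∃ Q : (W'.baseChange ℚ_[p]).toAffine.Point, p ^ n' • Q = W'.toPadicPoint p P') →
        (∀ Q : (W'.baseChange ℚ_[p]).toAffine.Point, p ^ (n' + 1) • Q ≠ W'.toPadicPoint p P') →
        ∀ (n₀ : ℕ), AcSelmer.XAc.HasCharValuationAt (W.baseChange K) p κ 𝔭 ∅ γ n₀ →
          Finite {x : AcSelmer.XAc (W.baseChange K) p κ 𝔭 ∅ γ //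
            (PowerSeries.X : IwasawaAlgebra p) • x = 0} →
          (n₀ : ℤ) + padicValNat p (Nat.card {x : AcSelmer.XAc (W.baseChange K) p κ 𝔭 ∅ γ //
              (PowerSeries.X : IwasawaAlgebra p) • x = 0}) =
            padicValNat p (Nat.card ↥(strictSelmerPInfty W p)) +
              padicValNat p (Nat.card ↥(strictSelmerPInfty W' p))

/-- **(R-EU) TYPED (the MISSING INPUT of O11; NOT in print; nothing asserted): the elliptic-unit
index formula at a CM-ramified prime in analytic rank one** (= Perrin-Riou's 1993 conjecture for the
CM zeta element of `E` at `p = |d_K|`, valuation form; ⟺ by BKNO Thm. 7.2 a BDP-type formula for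
BKNO's anticyclotomic `L_p(E)` at the trivial character, announced in BKNO §1.4 as "report
elsewhere"). For a framed pair with `r_an(W) = 1` and generators of levels `n`, `n'` as in (R-ctrl):
whenever `X` has the shape `ord_p f(0) = n₀` with `X[T]` finite,
  `n₀ + log_p #X[T] = n + n' + ord_p #Ш_an(W) + ord_p #Ш_an(W')`
for `#Ш_an(W) = q`, `#Ш_an(W') = q'` (rational by Gross–Zagier). By BKNO Thm. 3.14 (3) the left side
is `ord_π [E(K) ⊗ ℤ_p : 𝒪·z(𝟙)]`, the index of the bottom elliptic-unit class; so the statement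
locates that explicit class inside `E(K) ⊗ ℤ_p` exactly as BSD predicts. Given (R-ctrl) and the
discharged index theorem it is EQUIVALENT to `BSDp W p ∧ BSDp W' p` — its content is the elliptic-unit
reading, which makes it attackable by a `p`-adic Gross–Zagier / explicit-reciprocity argument at the
ramified prime (none in print: Kobayashi 2013 needs `p ∤ N`; BKO 2024 Thm. 1.1 is the INERT good
case). LABEL: CONSTRUCTION / OPEN; nothing asserted.
[cite: BurungaleKobayashiNakamuraOta2026, Thm. 7.2 and §1.4 (arXiv:2608.06879 pp. 8, 40) (claim; preprint; shape only)]
[cite: GrossZagier1986, Thm. I.(7.3) (rationality of #Ш_an)] [cite: Miller2011LMS, Def. 1.1] -/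
@[conjecture] def RamifiedCMEllipticUnitIndexAt : Prop :=
  ∀ (K : Type) [Field K] [NumberField K] (𝔭 : HeightOneSpectrum (𝓞 K))
    (W' : WeierstrassCurve ℚ) [W'.IsElliptic] [W'.IsGloballyMinimal] (C : VariableChange ℚ),
    IsFrame W p K 𝔭 W' C → W.analyticRank = 1 →
    ∀ (κ : ZpExtension K p), κ.IsAnticyclotomic →
      ∀ (γ : absoluteGaloisGroup K) [Fact (κ.IsTopGenerator γ)]
        (P : W.toAffine.Point) (n : ℕ) (P' : W'.toAffine.Point) (n' : ℕ),
        ¬ IsOfFinAddOrder P →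
        (∀ R : W.toAffine.Point, ∃ (k : ℤ) (T : W.toAffine.Point), IsOfFinAddOrder T ∧ R = k • P + T) →
        (∀ Q : (W.baseChange ℚ_[p]).toAffine.Point, p • Q = 0 → Q = 0) →
        (∃ Q : (W.baseChange ℚ_[p]).toAffine.Point, p ^ n • Q = W.toPadicPoint p P) →
        (∀ Q : (W.baseChange ℚ_[p]).toAffine.Point, p ^ (n + 1) • Q ≠ W.toPadicPoint p P) →
        ¬ IsOfFinAddOrder P' →
        (∀ R : W'.toAffine.Point, ∃ (k : ℤ) (T : W'.toAffine.Point),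
          IsOfFinAddOrder T ∧ R = k • P' + T) →
        (∀ Q : (W'.baseChange ℚ_[p]).toAffine.Point, p • Q = 0 → Q = 0) →
        (∃ Q : (W'.baseChange ℚ_[p]).toAffine.Point, p ^ n' • Q = W'.toPadicPoint p P') →
        (∀ Q : (W'.baseChange ℚ_[p]).toAffine.Point, p ^ (n' + 1) • Q ≠ W'.toPadicPoint p P') →
        ∀ (q q' : ℚ), shaAn W = (q : ℂ) → shaAn W' = (q' : ℂ) →
        ∀ (n₀ : ℕ), AcSelmer.XAc.HasCharValuationAt (W.baseChange K) p κ 𝔭 ∅ γ n₀ →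
          Finite {x : AcSelmer.XAc (W.baseChange K) p κ 𝔭 ∅ γ //
            (PowerSeries.X : IwasawaAlgebra p) • x = 0} →
          (n₀ : ℤ) + padicValNat p (Nat.card {x : AcSelmer.XAc (W.baseChange K) p κ 𝔭 ∅ γ //
              (PowerSeries.X : IwasawaAlgebra p) • x = 0}) =
            (n : ℤ) + n' + padicValRat p q + padicValRat p q'

/-! ## §3 PROVED consumer: the three inputs at a framed pair of analytic rank one give `BSD(W, p)` -/

section Consumer

variable {W p}
variable {K : Type} [Field K] [NumberField K] {𝔭 : HeightOneSpectrum (𝓞 K)}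
  {W' : WeierstrassCurve ℚ} [W'.IsElliptic] [W'.IsGloballyMinimal] {C : VariableChange ℚ}
  {κ : ZpExtension K p} {P : W.toAffine.Point} {n : ℕ} {P' : W'.toAffine.Point} {n' : ℕ}

/-- **(R-tors) ∧ (R-ctrl) ∧ (R-EU) ⟹ `BSD(W, p)`** at a framed O11 pair `(W, p)` of analytic rank one
(`W` CM, `p ≥ 5` CM-ramified, `W' ≅ W^{(d_K)}` globally minimal and `ℚ`-isogenous to `W` — binder
`hiso`, the degree-`p` isogeny `[√d_K]`), given generators `P`, `P'` with their `p`-divisibility levels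
and the named facts: Cassels' isogeny invariance of the BSD quotient (`hCassels`), Gross–Zagier
rationality (`hGZ`), GZK (`hGZK`), modularity (`hmod`). PROOF: (R-tors) supplies `n₀` and the
finiteness of `X[T]`; (R-ctrl) and (R-EU) give `log_p #Sel_str(W) + log_p #Sel_str(W') = n + n' +
ord_p q + ord_p q'`; the DISCHARGED index theorem (`StrictSha.strictSelmerIndexAt_holds`, for `W` and
for `W'`) turns this into `ord_p #Ш(W)[p^∞] + ord_p #Ш(W')[p^∞] = ord_p q + ord_p q'`; Cassels along
`W ∼ W'` gives `q = q' · #Ш(W)/#Ш(W')`, so the two defects `ord_p q − ord_p #Ш` coincide and both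
vanish. CONDITIONAL on the three typed inputs (two derived in the memo, one OPEN); nothing booked.
[cite: Cassels1965ArithmeticVIII] [cite: MilneADT2006, Thm. I.7.3] [cite: GrossZagier1986, Thm. I.(7.3)]
[cite: Miller2011LMS, §1 and Def. 1.1] -/
theorem bsdp_of_halves (hmod : hasEntireLFunction_rat) (hGZ : GrossZagier1986_thm_I_7_3)
    (hGZK : rank_eq_analyticRank_of_analyticRank_le_one) (hCassels : bsdRHS_eq_of_isIsogenous)
    (h1 : RamifiedCMStrictTorsionAt W p) (h2 : RamifiedCMStrictControlAt W p)
    (h3 : RamifiedCMEllipticUnitIndexAt W p)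
    (hF : IsFrame W p K 𝔭 W' C) (hiso : IsIsogenous W W') (hr : W.analyticRank = 1)
    (hκ : κ.IsAnticyclotomic) (γ : absoluteGaloisGroup K) [Fact (κ.IsTopGenerator γ)]
    (hP : ¬ IsOfFinAddOrder P)
    (hgen : ∀ R : W.toAffine.Point, ∃ (k : ℤ) (T : W.toAffine.Point),
      IsOfFinAddOrder T ∧ R = k • P + T)
    (htors : ∀ Q : (W.baseChange ℚ_[p]).toAffine.Point, p • Q = 0 → Q = 0)
    (hdiv : ∃ Q : (W.baseChange ℚ_[p]).toAffine.Point, p ^ n • Q = W.toPadicPoint p P)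
    (hndiv : ∀ Q : (W.baseChange ℚ_[p]).toAffine.Point, p ^ (n + 1) • Q ≠ W.toPadicPoint p P)
    (hP' : ¬ IsOfFinAddOrder P')
    (hgen' : ∀ R : W'.toAffine.Point, ∃ (k : ℤ) (T : W'.toAffine.Point),
      IsOfFinAddOrder T ∧ R = k • P' + T)
    (htors' : ∀ Q : (W'.baseChange ℚ_[p]).toAffine.Point, p • Q = 0 → Q = 0)
    (hdiv' : ∃ Q : (W'.baseChange ℚ_[p]).toAffine.Point, p ^ n' • Q = W'.toPadicPoint p P')
    (hndiv' : ∀ Q : (W'.baseChange ℚ_[p]).toAffine.Point, p ^ (n' + 1) • Q ≠ W'.toPadicPoint p P') :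
    BSDp W p := by
  -- ranks and finiteness of `Ш` for `W` and for the isogenous `W'` (GZK)
  obtain ⟨hrank, hfin⟩ := hGZK W hr.le
  haveI : Finite W.sha := hfin
  have hr' : W'.analyticRank = 1 := by rw [← analyticRank_eq_of_isIsogenous' hiso, hr]
  obtain ⟨-, hfin'⟩ := hGZK W' hr'.le
  haveI : Finite W'.sha := hfin'
  -- `#Ш_an ∈ ℚ^×` for both
  obtain ⟨q, hq⟩ := Disegni2020.exists_rat_shaAn_eq_of_analyticRank_eq_one hGZ hGZK W hr
  obtain ⟨q', hq'⟩ := Disegni2020.exists_rat_shaAn_eq_of_analyticRank_eq_one hGZ hGZK W' hr'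
  have hq0 : q ≠ 0 := by
    rintro rfl
    exact AdditivePotMult.shaAn_ne_zero W hmod (by rw [hq, Rat.cast_zero])
  have hq0' : q' ≠ 0 := by
    rintro rfl
    exact AdditivePotMult.shaAn_ne_zero W' hmod (by rw [hq', Rat.cast_zero])
  -- the three inputs
  obtain ⟨⟨n₀, hchar⟩, hfinT⟩ := h1 K 𝔭 W' C hF hr κ hκ γ
  have hctrl := h2 K 𝔭 W' C hF hr κ hκ γ P n P' n' hP hgen htors hdiv hndiv hP' hgen' htors' hdiv'
    hndiv' n₀ hchar hfinT
  have heu := h3 K 𝔭 W' C hF hr κ hκ γ P n P' n' hP hgen htors hdiv hndiv hP' hgen' htors' hdiv'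
    hndiv' q q' hq hq' n₀ hchar hfinT
  -- the DISCHARGED index theorem, for `W` and for `W'`
  haveI : Finite (AddCommGroup.primaryComponent W.sha p) := inferInstance
  haveI : Finite (AddCommGroup.primaryComponent W'.sha p) := inferInstance
  have hI := (StrictSha.strictSelmerIndexAt_holds W p).padicValNat_card_eq hP hgen htors hdiv hndiv
  have hI' := (StrictSha.strictSelmerIndexAt_holds W' p).padicValNat_card_eq hP' hgen' htors' hdiv'
    hndiv'
  -- sum identity: `ord_p #Ш(W)(p) + ord_p #Ш(W')(p) = ord_p q + ord_p q'`
  have hsum : (padicValNat p (Nat.card (AddCommGroup.primaryComponent W.sha p)) : ℤ) +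
      padicValNat p (Nat.card (AddCommGroup.primaryComponent W'.sha p)) =
      padicValRat p q + padicValRat p q' := by
    rw [hI, hI', Nat.cast_add, Nat.cast_add] at hctrl
    linarith
  -- Cassels along `W ∼ W'`: `#Ш_an(W) · #Ш(W') = #Ш_an(W') · #Ш(W)`
  obtain ⟨-, hRHS⟩ := hCassels W W' hiso hfin
  have hlead_eq : W.leadingLCoeff = W'.leadingLCoeff := leadingLCoeff_eq_of_isIsogenous' hiso
  have h1W := Wuthrich2014.shaAn_mul_bsdRHS W
  have h1W' := Wuthrich2014.shaAn_mul_bsdRHS W'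
  have hshaQ : (W.shaOrder : ℚ) ≠ 0 := by exact_mod_cast (W.shaOrder_pos hfin).ne'
  have hshaQ' : (W'.shaOrder : ℚ) ≠ 0 := by exact_mod_cast (W'.shaOrder_pos hfin').ne'
  have hRHS0 : (W.bsdRHS : ℂ) ≠ 0 := by exact_mod_cast W.bsdRHS_ne_zero hfin
  have hkey : (q : ℂ) * (W'.shaOrder : ℂ) = (q' : ℂ) * (W.shaOrder : ℂ) := by
    rw [hq] at h1W
    rw [hq', hRHS, ← hlead_eq] at h1W'
    have h3 : ((q : ℂ) * (W'.shaOrder : ℂ)) * (W.bsdRHS : ℂ) =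
        ((q' : ℂ) * (W.shaOrder : ℂ)) * (W.bsdRHS : ℂ) := by
      calc ((q : ℂ) * (W'.shaOrder : ℂ)) * (W.bsdRHS : ℂ)
          = ((q : ℂ) * (W.bsdRHS : ℂ)) * (W'.shaOrder : ℂ) := by ring
        _ = (W.leadingLCoeff * (W.shaOrder : ℂ)) * (W'.shaOrder : ℂ) := by rw [h1W]
        _ = (W.leadingLCoeff * (W'.shaOrder : ℂ)) * (W.shaOrder : ℂ) := by ring
        _ = ((q' : ℂ) * (W.bsdRHS : ℂ)) * (W.shaOrder : ℂ) := by rw [h1W']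
        _ = ((q' : ℂ) * (W.shaOrder : ℂ)) * (W.bsdRHS : ℂ) := by ring
    exact mul_right_cancel₀ hRHS0 h3
  have hkeyQ : q * (W'.shaOrder : ℚ) = q' * (W.shaOrder : ℚ) := by exact_mod_cast hkey
  have hval : padicValRat p q + (padicValNat p W'.shaOrder : ℤ) =
      padicValRat p q' + (padicValNat p W.shaOrder : ℤ) := by
    have h := congrArg (padicValRat p) hkeyQ
    rwa [padicValRat.mul hq0 hshaQ', padicValRat.mul hq0' hshaQ, padicValRat.of_nat,
      padicValRat.of_nat] at h
  refine ⟨hrank, inferInstance, q, hq, ?_⟩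
  rw [padicValNat_card_addPrimaryComponent, padicValNat_card_addPrimaryComponent] at hsum
  rw [padicValNat_card_addPrimaryComponent]
  have e1 : W.shaOrder = Nat.card W.sha := rfl
  have e2 : W'.shaOrder = Nat.card W'.sha := rfl
  rw [e1, e2] at hval
  linarith

end Consumer

end Summit.BirchSwinnertonDyer.Rank1Residual.X12.O11

end
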